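import Summits.BirchSwinnertonDyer.Rank1Residual.AdditivePotMult.LowerHalvesSuffice
import Summits.BirchSwinnertonDyer.Rank1Residual.AdditivePotMult.RankZeroChiBranchPrimeFacts
import Summits.BirchSwinnertonDyer.Rank1Residual.X2.TwistTamagawa
import Literature.NumberTheory.EllipticCurves.Rank1Residual.ClassX1KellerYin
import HarnessLib

/-!
# Rank ONE at an additive potentially multiplicative prime, EVERY ODD `p` (so `p = 3`): Kolyvagin's
# Tamagawa-defect inequality relative to the rank-zero Heegner twist's lower half, and on
# X4(M) ∧ surj(p) `BSD(E,p)` in BOTH analytic ranks from LOWER halves alone (cell `b2b-bsdres`, seat additive-p1, gen 10)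

HONEST FRAMING (cell `b2b-bsdres`, run/shared/lean/b2b/bsd-rank1-residual/, verbatim in every
file): the goal of the cell is to DELETE the COMBINATION-SHAPED residual classes of the
Birch–Swinnerton-Dyer formula for ALL analytic-rank `≤ 1` elliptic curves over `ℚ` — "full BSD
formula for every rank `≤ 1` curve in class `C`" assembled STRICTLY from published theorems — so
that the rank-`≤ 1` remainder becomes exactly the CONSTRUCTION-SHAPED classes, which are TYPED
(missing-input `Prop`s), NOT attempted. This is not "finishing BSD". The additive sub-cell (seats
additive-p1…p4) is a RESEARCH ROUTE on the construction-shaped classes X3/X4; sub-cell additive-p1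
= the potentially MULTIPLICATIVE additive prime (X3♯(M) / X4(M)); no claim beyond the stated
classes; the labels of X3/X4 are UNCHANGED by this file; nothing is booked.

Theorems only (no definition, no new named fact). Gen 4 of this seat proved Kolyvagin's
Tamagawa-defect inequality in RANK ONE at a BAD prime relative to the LOWER half of the rank-zero
Heegner twist (`RankOneHeegner[Class].lean`) and the capstone "on X4(M) under big image, in both
ranks, `BSD(E,p)` follows from lower halves alone" (`LowerHalvesSuffice.lean`) — at `p ≥ 5` only,
for two reasons: the Tamagawa transport along the Heegner twist used Kodaira–Néron `c_ℓ ≤ 4 < p` at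
`ℓ ∣ d_K` (multr1-p2's `X11b.padicValNat_tamagawaProduct_twist_of_heegner`), and the rank-zero half
was Kim's theorem (`p ≥ 5`, Manin, `p ∤ ∏c_ℓ`). Both reasons are gone: eisenstein-p2 proved the
transport at EVERY ODD `p ∤ d_K` for `d_K` ODD (`X2.padicValNat_tamagawaProduct_twist_of_heegner_of_odd`:
type `I₀*` at `ℓ ∣ d_K`, `c_ℓ ∈ {1,2,4}`), x1a's `exists_admissibleField_of_rootNumber_eq_neg_one`
(Hoffstein–Luo 1997 + the sign from modularity) supplies such a field (`d_K ≡ 1 (mod 8)`, `d_K < −4`,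
every prime of `N_E` split, `L(E^{(d_K)},1) ≠ 0`), and gen 9 proved the rank-zero UPPER half on
X4(M) ∧ surj(p) at every odd `p` from published facts with NO Tamagawa / Manin / `p ≥ 5` hypothesis
(`ClassX4M.bsdp_rankZero_of_surj_of_lower`). Contents: §1 data level (any bad odd `p`, `d_K` odd);
§2 class level at any bad ODD `p` with `E[p]` irreducible, `ρ̄_{E,p}` onto (Kolyvagin's bound in
McCallum's form: `p` odd, image `GL₂(𝔽_p)` — valid at `p = 3`) and a Manin datum; §3 X4(M):
rank one from the rank-zero twists' lower halves (surj(p) also decided by `p ∤ ord_p j(E)`), and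
**`bsdp_of_classX4M_of_surj_of_lowerHalves_of_odd`**: on X4(M) ∧ surj(p), `ord_{s=1} L(E,s) ≤ 1`,
Manin datum and `p ∤ ∏c_ℓ(E)` (used in rank one only), `BSD(E,p)` ⇐ the LOWER halves of the X4(M)
pairs with the same `j` — every other input PUBLISHED — at EVERY odd `p`, in particular `p = 3`,
where 87 of the 98 rank-one X4(M) census pairs (`N < 2·10⁴`) live (85 with surj(3), 73 by
`3 ∤ ord₃ j`; 52 with `3 ∤ ∏c_ℓ`). NOT reached: X3♯(M) in rank one (`E[p]` reducible; Kolyvagin's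
bound as printed needs `ρ̄` onto; 221 census pairs at `p = 3`, 15 at `p ≥ 5`) — typed, unchanged;
the 2 rank-one X4(M) pairs at `p = 3` with image `3Ns` (2178h1, 11520p1); and everywhere the LOWER
halves themselves (SU direction on the `ω^{(p−1)/2}`-branch, printed nowhere). Nothing booked.

References: [McCallumLMS1991] §1 Theorem, p. 296; [GrossLMS1991] Thm. 1.3; [JetchevSkinnerWan2017]
§7.4.1–7.4.2; [HoffsteinLuo1997] Theorem; [CastellaEtAl2021] proof of Thm. 5.3.1 (a)–(d);
[SilvermanATAEC1994] IV.9.4 Table 4.1; [Miller2011LMS] Def. 1.1; [Delbourgo1998] Prop. 4;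
[Wuthrich2014] Lemma 20, Thm. 3, Cor. 19; [Kato2004Asterisque] Thm. 17.4.
-/

noncomputable section

open scoped Classical NumberField

open WeierstrassCurve NumberField Literature.NumberTheory.EllipticCurves
  Literature.NumberTheory.EllipticCurves.ModularForms
  Literature.NumberTheory.EllipticCurves.Rank1Residual
  Literature.NumberTheory.EllipticCurves.Rank1Residual.Typed
  Literature.NumberTheory.Automorphic
  IsDedekindDomain

namespace Summit.BirchSwinnertonDyer.Rank1Residual.AdditivePotMult

/-! ### §1 Data level, any bad odd `p`, Heegner field with odd discriminant -/

/-- **Kolyvagin's Tamagawa defect at fixed Heegner data, at ANY bad ODD prime — relative form.**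
`W/ℚ` globally minimal of conductor `N`, `ord_{s=1} L(E,s) = 1`, `p ∣ N` odd (multiplicative OR
additive), `E[p]` irreducible; `K` imaginary quadratic with `d_K` ODD, Heegner hypothesis for `N`
(so `p ∤ d_K`), `p ∤ #𝓞_K^×`, `L(E^{(d_K)},1) ≠ 0`; datum `Dt` at level `N` with `p ∤ c(Dt)` (a
HYPOTHESIS at an additive `p`), Heegner datum `H`, `P ∈ E(K)` over the complex Heegner point, `Wd` a
globally minimal model of `E^{(d_K)}`, a Kolyvagin-shape bound over `K` (`hU`), and the LOWER half
`MissingLowerBoundAt Wd p` of the RANK-ZERO twist ⟹ `#Ш(E)_an = q ∈ ℚ`,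
`ord_p #Ш(E) ≤ ord_p q + 2·ord_p ∏_ℓ c_ℓ(E)`. Gen 4's theorem with `p ≥ 5` replaced by `p` odd +
`d_K` odd: Tamagawa transport = eisenstein-p2's `X2.padicValNat_tamagawaProduct_twist_of_heegner_of_odd`
(type `I₀*` at `ℓ ∣ d_K`), the rest = multr1-p2's core `X11b.padicValNat_shaOrder_le_add_of_shaIndexBound`.
[cite: McCallumLMS1991, §1 Theorem (Kolyvagin), p. 296] [cite: JetchevSkinnerWan2017, §7.4.1–7.4.2 (pp. 29–31)]
[cite: SilvermanATAEC1994, IV.9.4 Table 4.1 and Cor. IV.9.2(d)] [cite: Miller2011LMS, Def. 1.1] -/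
theorem padicValNat_shaOrder_le_add_of_heegnerData_of_lowerTwist_of_odd
    (W : WeierstrassCurve ℚ) [W.IsElliptic] [W.IsGloballyMinimal] (p : ℕ) [Fact p.Prime]
    [NeZero (W.conductorNorm ℤ)] (K : Type) [Field K] [NumberField K]
    (Dt : ModularParametrizationData W (W.conductorNorm ℤ))
    (H : HeegnerDatum (W.conductorNorm ℤ) (NumberField.discr K)) (ι : K →+* ℂ)
    (P : (W.baseChange K).toAffine.Point)
    -- the published inputs (named facts of the tree)
    (hGZ : gross_zagier (W.conductorNorm ℤ) W K) (hKo : kolyvagin (W.conductorNorm ℤ) W K)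
    (hGZK : rank_eq_analyticRank_of_analyticRank_le_one) (hmod : hasEntireLFunction_rat)
    -- the pair
    (hr : W.analyticRank = 1) (hp2 : p ≠ 2) (hpN : p ∣ W.conductorNorm ℤ) (hirr : Irr W p)
    -- the Heegner data
    (hK : IsImaginaryQuadratic K) (hodd : Odd (NumberField.discr K))
    (hHN : SatisfiesHeegnerHypothesis (W.conductorNorm ℤ) K)
    (hP : WeierstrassCurve.Affine.Point.map ι.toRatAlgHom P = heegnerPointComplex Dt H)
    (hc : ¬ (p : ℤ) ∣ Dt.c) (hμ : ¬ p ∣ Units.torsionOrder K)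
    (hLt : (W.quadraticTwist (NumberField.discr K : ℚ)).entireLFunction 1 ≠ 0)
    (Wd : WeierstrassCurve ℚ) [Wd.IsElliptic] [Wd.IsGloballyMinimal] (Cd : VariableChange ℚ)
    (hWd : Cd • W.quadraticTwist (NumberField.discr K : ℚ) = Wd)
    -- the ONE non-published input: the lower half for the rank-zero twist
    (hlow : MissingLowerBoundAt Wd p)
    -- an upper bound of Kolyvagin's shape over `K`
    (hU : Finite (W.baseChange K).sha → ¬ IsOfFinAddOrder P →
      padicValNat p (Nat.card (W.baseChange K).sha) ≤
        2 * padicValNat p (AddSubgroup.zmultiples P).index) :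
    ∃ q : ℚ, shaAn W = (q : ℂ) ∧
      (padicValNat p W.shaOrder : ℤ) ≤ padicValRat p q + 2 * padicValNat p W.tamagawaProduct := by
  have hp : p.Prime := Fact.out
  have hD0 : (NumberField.discr K : ℚ) ≠ 0 := by exact_mod_cast NumberField.discr_ne_zero K
  haveI hEt : (W.quadraticTwist (NumberField.discr K : ℚ)).IsElliptic :=
    W.isElliptic_quadraticTwist hD0
  -- `p ∣ N` splits in `K`, so `p ∤ d_K`
  have hpd : ¬ (p : ℤ) ∣ NumberField.discr K :=
    Literature.SatisfiesHeegnerHypothesis.not_dvd_discr hK.1 hHN hp hpN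
  -- transports to the minimal twist model
  have hirrd : Wd.HasIrreducibleModPGaloisRep p :=
    X11b.hasIrreducibleModPGaloisRep_twist_model W p K hK.1 hirr Cd hWd
  have htam : padicValNat p Wd.tamagawaProduct = padicValNat p W.tamagawaProduct :=
    X2.padicValNat_tamagawaProduct_twist_of_heegner_of_odd W p hp2 K hK hodd hpd hHN Cd hWd
  have hu : padicValRat p (Cd.u : ℚ) = 0 :=
    padicValRat_u_eq_zero_of_twist_minimal_of_dvd W p K hK hHN hpN Cd hWd
  -- the twist has analytic rank `0`
  have hLt' : (W.quadraticTwist (NumberField.discr K : ℚ)).entireLFunction = Wd.entireLFunction := by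
    rw [← hWd, entireLFunction_smul]
  have hLd1 : Wd.entireLFunction 1 ≠ 0 := by rw [← hLt']; exact hLt
  have hrd : Wd.analyticRank = 0 := (Wd.analyticRank_eq_zero_iff_holds (hmod Wd)).2 hLd1
  -- the lower half in print shape
  obtain ⟨qd, hqd, hvqd⟩ :=
    exists_printShape_lower_of_missingLowerBoundAt_rankZero (p := p) Wd hGZK hrd hirrd hlow
  exact X11b.padicValNat_shaOrder_le_add_of_shaIndexBound W p (W.conductorNorm ℤ) K Dt H ι P hGZ hKo
    hGZK hmod hK hHN hP hp2 hc hμ hr hLt Wd Cd hWd hu htam ⟨qd, hqd, hvqd⟩ hU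

/-! ### §2 Class level, any bad odd `p`: the field by Hoffstein–Luo, the point by Gross–Darmon -/

/-- **Kolyvagin's Tamagawa defect at an ADDITIVE (or any bad) ODD prime, rank one, relative to the
rank-zero Heegner twists' lower halves.** `W/ℚ` globally minimal, `ord_{s=1} L(E,s) = 1`, `p` an ODD
prime of BAD reduction with `E[p]` irreducible and `ρ̄_{E,p}` onto, `D` a datum at level `N_E` with
`p ∤ c(D)`; ASSUME `MissingLowerBoundAt Wd p` for every globally minimal model `Wd` of a rank-zero
twist `E^{(d_K)}` by an imaginary quadratic Heegner field `K`. Then `#Ш(E)_an = q ∈ ℚ`,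
`ord_p #Ш(E) ≤ ord_p q + 2·ord_p ∏_ℓ c_ℓ(E)`. PUBLISHED binders: Gross–Zagier `hGZ`, Kolyvagin `hKo`,
`hB` (McCallum's form of the `Ш`-bound: `p` odd, `ρ̄` onto — valid at `p = 3`), GZK `hGZK`,
modularity `hmod`/`hnf`, Hoffstein–Luo `hHL` (x1a's `exists_admissibleField_of_rootNumber_eq_neg_one`:
`d_K ≡ 1 (mod 8)`, `d_K < −4` so `w_K = 2`, every prime of `N_E` split, `L(E^{(d_K)},1) ≠ 0`);
Heegner datum / `K`-rational point by `nonempty_heegnerDatum_holds`,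
`heegnerPointComplex_mem_range_map_holds`. Gen 4's theorem without `p ≥ 5`. Nothing booked.
[cite: McCallumLMS1991, §1 Theorem (Kolyvagin), p. 296] [cite: HoffsteinLuo1997, Theorem (§1, pp. 435–436)]
[cite: CastellaEtAl2021, proof of Thm. 5.3.1, conditions (a)–(d)] [cite: Miller2011LMS, Def. 1.1] -/
theorem padicValNat_shaOrder_le_add_of_bad_rankOne_of_lowerTwists_of_odd
    (hGZ : ∀ (N : ℕ) [NeZero N] (W : WeierstrassCurve ℚ) (K : Type) [Field K] [NumberField K],
      gross_zagier N W K)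
    (hKo : ∀ (N : ℕ) [NeZero N] (W : WeierstrassCurve ℚ) (K : Type) [Field K] [NumberField K],
      kolyvagin N W K)
    (hB : ∀ (N : ℕ) [NeZero N] (W : WeierstrassCurve ℚ) (K : Type) [Field K] [NumberField K],
      Kolyvagin1990_padicValNat_card_sha_le N W K)
    (hGZK : rank_eq_analyticRank_of_analyticRank_le_one) (hmod : hasEntireLFunction_rat)
    (hnf : exists_isNewformOf) (hHL : HoffsteinLuo1997_exists_twist_L_one_ne_zero)
    (W : WeierstrassCurve ℚ) [W.IsElliptic] [W.IsGloballyMinimal] (p : ℕ) [Fact p.Prime]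
    [NeZero (W.conductorNorm ℤ)]
    (hbad : ¬ Good W p) (hirr : Irr W p) (hsurj : Surj W p) (hp2 : p ≠ 2) (hr : W.analyticRank = 1)
    (D : ModularParametrizationData W (W.conductorNorm ℤ)) (hc : ¬ (p : ℤ) ∣ D.c)
    (hlow : ∀ (K : Type) [Field K] [NumberField K] (Wd : WeierstrassCurve ℚ) [Wd.IsElliptic]
      [Wd.IsGloballyMinimal], IsImaginaryQuadratic K →
      SatisfiesHeegnerHypothesis (W.conductorNorm ℤ) K →
      (∃ C : VariableChange ℚ, C • W.quadraticTwist (NumberField.discr K : ℚ) = Wd) →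
      Wd.analyticRank = 0 → MissingLowerBoundAt Wd p) :
    ∃ q : ℚ, shaAn W = (q : ℂ) ∧
      (padicValNat p W.shaOrder : ℤ) ≤ padicValRat p q + 2 * padicValNat p W.tamagawaProduct := by
  have hp : p.Prime := Fact.out
  have hpN : p ∣ W.conductorNorm ℤ := (W.dvd_conductorNorm_iff_not_hasGoodReductionAtPrime p).mpr hbad
  -- the sign of the functional equation is `−1` (modularity, `r_an = 1`)
  have hw : W.rootNumber = -1 := by
    rw [WeierstrassCurve.rootNumber_eq_neg_one_pow_analyticRank_of_exists_isNewformOf hnf W, hr]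
    norm_num
  -- the admissible field (Hoffstein–Luo): `d_K` odd, `d_K < -4`, every `ℓ ∣ N` split, `L(E^{d_K},1) ≠ 0`
  obtain ⟨K, _, _, hK, hodd, hd4, hHN, -, hLt⟩ :=
    exists_admissibleField_of_rootNumber_eq_neg_one hnf hHL W hw p
  -- `w_K = 2`, prime to the odd `p`
  have hμ : ¬ p ∣ Units.torsionOrder K := by
    rw [Literature.NumberTheory.DiophantineGeometry.torsionOrder_eq_two_of_discr_lt hK.1 hd4]
    intro h2
    exact hp2 ((Nat.prime_dvd_prime_iff_eq hp Nat.prime_two).mp h2)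
  -- the Heegner datum and the `K`-rational Heegner point of the given parametrisation datum `D`
  obtain ⟨β, hβ⟩ := exists_dvd_sq_sub_discr_holds (W.conductorNorm ℤ) K hK hHN
  obtain ⟨H, -⟩ := nonempty_heegnerDatum_holds (W.conductorNorm ℤ) K hK hβ
  obtain ⟨ι⟩ : Nonempty (K →+* ℂ) := inferInstance
  obtain ⟨P, hP⟩ := heegnerPointComplex_mem_range_map_holds (W.conductorNorm ℤ) W K hK hHN D H ι
  -- a globally minimal model of the twist
  have hD0 : (NumberField.discr K : ℚ) ≠ 0 := by exact_mod_cast NumberField.discr_ne_zero K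
  haveI hEt : (W.quadraticTwist (NumberField.discr K : ℚ)).IsElliptic :=
    W.isElliptic_quadraticTwist hD0
  obtain ⟨Cd, hCd⟩ := hasGlobalMinimalModel_rat_holds (W.quadraticTwist (NumberField.discr K : ℚ))
  haveI : (Cd • W.quadraticTwist (NumberField.discr K : ℚ)).IsGloballyMinimal := hCd
  have hWd : Cd • W.quadraticTwist (NumberField.discr K : ℚ) =
      Cd • W.quadraticTwist (NumberField.discr K : ℚ) := rfl
  -- the twist has analytic rank `0`
  have hrd : (Cd • W.quadraticTwist (NumberField.discr K : ℚ)).analyticRank = 0 := by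
    rw [analyticRank_smul]
    exact analyticRank_eq_zero_of_entireLFunction_one_ne_zero _ hLt
  have hlowd := hlow K (Cd • W.quadraticTwist (NumberField.discr K : ℚ)) hK hHN ⟨Cd, rfl⟩ hrd
  exact padicValNat_shaOrder_le_add_of_heegnerData_of_lowerTwist_of_odd W p K D H ι P (hGZ _ W K)
    (hKo _ W K) hGZK hmod hr hp2 hpN hirr hK hodd hHN hP hc hμ hLt
    (Cd • W.quadraticTwist (NumberField.discr K : ℚ)) Cd hWd hlowd
    (fun _ hnt ↦ hB _ W K hK hHN ⟨D, H, ι, hP⟩ hnt hp hp2 hsurj)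

/-- **The upper half on `p ∤ ∏ c_ℓ`, any bad ODD `p`** (same hypotheses): `Typed.MissingUpperBoundAt W p`
(`ord_p #Ш(E) ≤ ord_p #Ш(E)_an`). [cite: McCallumLMS1991, §1 Theorem (Kolyvagin), p. 296]
[cite: Miller2011LMS, Def. 1.1] -/
theorem missingUpperBoundAt_of_bad_rankOne_of_lowerTwists_of_odd
    (hGZ : ∀ (N : ℕ) [NeZero N] (W : WeierstrassCurve ℚ) (K : Type) [Field K] [NumberField K],
      gross_zagier N W K)
    (hKo : ∀ (N : ℕ) [NeZero N] (W : WeierstrassCurve ℚ) (K : Type) [Field K] [NumberField K],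
      kolyvagin N W K)
    (hB : ∀ (N : ℕ) [NeZero N] (W : WeierstrassCurve ℚ) (K : Type) [Field K] [NumberField K],
      Kolyvagin1990_padicValNat_card_sha_le N W K)
    (hGZK : rank_eq_analyticRank_of_analyticRank_le_one) (hmod : hasEntireLFunction_rat)
    (hnf : exists_isNewformOf) (hHL : HoffsteinLuo1997_exists_twist_L_one_ne_zero)
    (W : WeierstrassCurve ℚ) [W.IsElliptic] [W.IsGloballyMinimal] (p : ℕ) [Fact p.Prime]
    [NeZero (W.conductorNorm ℤ)]
    (hbad : ¬ Good W p) (hirr : Irr W p) (hsurj : Surj W p) (hp2 : p ≠ 2) (hr : W.analyticRank = 1)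
    (D : ModularParametrizationData W (W.conductorNorm ℤ)) (hc : ¬ (p : ℤ) ∣ D.c)
    (htam : ¬ p ∣ W.tamagawaProduct)
    (hlow : ∀ (K : Type) [Field K] [NumberField K] (Wd : WeierstrassCurve ℚ) [Wd.IsElliptic]
      [Wd.IsGloballyMinimal], IsImaginaryQuadratic K →
      SatisfiesHeegnerHypothesis (W.conductorNorm ℤ) K →
      (∃ C : VariableChange ℚ, C • W.quadraticTwist (NumberField.discr K : ℚ) = Wd) →
      Wd.analyticRank = 0 → MissingLowerBoundAt Wd p) :
    MissingUpperBoundAt W p := by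
  obtain ⟨q, hq, hle⟩ := padicValNat_shaOrder_le_add_of_bad_rankOne_of_lowerTwists_of_odd hGZ hKo hB
    hGZK hmod hnf hHL W p hbad hirr hsurj hp2 hr D hc hlow
  refine ⟨q, hq, ?_⟩
  rw [padicValNat.eq_zero_of_not_dvd htam, Nat.cast_zero, mul_zero, add_zero] at hle
  exact hle

/-- **`BSD(E,p)` in rank one at a bad ODD prime from LOWER halves only** (same hypotheses, plus the
lower half `MissingLowerBoundAt W p` for `E` itself). [cite: McCallumLMS1991, §1 Theorem (Kolyvagin), p. 296]
[cite: Miller2011LMS, Def. 1.1] -/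
theorem bsdp_of_bad_rankOne_of_lower_of_lowerTwists_of_odd
    (hGZ : ∀ (N : ℕ) [NeZero N] (W : WeierstrassCurve ℚ) (K : Type) [Field K] [NumberField K],
      gross_zagier N W K)
    (hKo : ∀ (N : ℕ) [NeZero N] (W : WeierstrassCurve ℚ) (K : Type) [Field K] [NumberField K],
      kolyvagin N W K)
    (hB : ∀ (N : ℕ) [NeZero N] (W : WeierstrassCurve ℚ) (K : Type) [Field K] [NumberField K],
      Kolyvagin1990_padicValNat_card_sha_le N W K)
    (hGZK : rank_eq_analyticRank_of_analyticRank_le_one) (hmod : hasEntireLFunction_rat)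
    (hnf : exists_isNewformOf) (hHL : HoffsteinLuo1997_exists_twist_L_one_ne_zero)
    (W : WeierstrassCurve ℚ) [W.IsElliptic] [W.IsGloballyMinimal] (p : ℕ) [Fact p.Prime]
    [NeZero (W.conductorNorm ℤ)]
    (hbad : ¬ Good W p) (hirr : Irr W p) (hsurj : Surj W p) (hp2 : p ≠ 2) (hr : W.analyticRank = 1)
    (D : ModularParametrizationData W (W.conductorNorm ℤ)) (hc : ¬ (p : ℤ) ∣ D.c)
    (htam : ¬ p ∣ W.tamagawaProduct) (hlowW : MissingLowerBoundAt W p)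
    (hlow : ∀ (K : Type) [Field K] [NumberField K] (Wd : WeierstrassCurve ℚ) [Wd.IsElliptic]
      [Wd.IsGloballyMinimal], IsImaginaryQuadratic K →
      SatisfiesHeegnerHypothesis (W.conductorNorm ℤ) K →
      (∃ C : VariableChange ℚ, C • W.quadraticTwist (NumberField.discr K : ℚ) = Wd) →
      Wd.analyticRank = 0 → MissingLowerBoundAt Wd p) :
    BSDp W p :=
  bsdp_of_missingPPartAt W p hGZK (by rw [hr])
    (missingPPartAt_of_lower_of_upper W p hlowW
      (missingUpperBoundAt_of_bad_rankOne_of_lowerTwists_of_odd hGZ hKo hB hGZK hmod hnf hHL W p hbad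
        hirr hsurj hp2 hr D hc htam hlow))

/-! ### §3 X4(M), every odd `p`: rank one from the rank-zero twists' lower halves; both ranks from lower halves alone -/

variable {W : WeierstrassCurve ℚ} [W.IsElliptic] [W.IsGloballyMinimal] {p : ℕ} [Fact p.Prime]

/-- **X4(M) ∧ surj(p), RANK ONE, ANY odd `p` (so `p = 3`), Manin datum, `p ∤ ∏c_ℓ(E)`: the UPPER half
of `BSD(E,p)` from the LOWER halves of the RANK-ZERO X4(M) pairs with the same `j`-invariant** (the
Heegner twists are such pairs, `ClassX4M.twist_of_heegner`). At `p = 3` this is new: 87 of the 98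
rank-one X4(M) census pairs (`N < 2·10⁴`) are at `p = 3`, 85 of them with surj(3). X4(M) stays
CONSTRUCTION-SHAPED; nothing booked. [cite: McCallumLMS1991, §1 Theorem (Kolyvagin), p. 296]
[cite: HoffsteinLuo1997, Theorem (§1, pp. 435–436)] [cite: Miller2011LMS, Def. 1.1] -/
theorem ClassX4M.missingUpperBoundAt_rankOne_of_surj_of_lowerTwists_of_odd
    (hGZ : ∀ (N : ℕ) [NeZero N] (W : WeierstrassCurve ℚ) (K : Type) [Field K] [NumberField K],
      gross_zagier N W K)
    (hKo : ∀ (N : ℕ) [NeZero N] (W : WeierstrassCurve ℚ) (K : Type) [Field K] [NumberField K],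
      kolyvagin N W K)
    (hB : ∀ (N : ℕ) [NeZero N] (W : WeierstrassCurve ℚ) (K : Type) [Field K] [NumberField K],
      Kolyvagin1990_padicValNat_card_sha_le N W K)
    (hGZK : rank_eq_analyticRank_of_analyticRank_le_one) (hmod : hasEntireLFunction_rat)
    (hnf : exists_isNewformOf) (hHL : HoffsteinLuo1997_exists_twist_L_one_ne_zero)
    [NeZero (W.conductorNorm ℤ)]
    (hX : ClassX4M W p) (hr : W.analyticRank = 1) (hsurj : Surj W p)
    (D : ModularParametrizationData W (W.conductorNorm ℤ)) (hc : ¬ (p : ℤ) ∣ D.c)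
    (htam : ¬ p ∣ W.tamagawaProduct)
    (hlow : ∀ (V : WeierstrassCurve ℚ) [V.IsElliptic] [V.IsGloballyMinimal], ClassX4M V p →
      V.j = W.j → V.analyticRank = 0 → MissingLowerBoundAt V p) :
    MissingUpperBoundAt W p :=
  missingUpperBoundAt_of_bad_rankOne_of_lowerTwists_of_odd hGZ hKo hB hGZK hmod hnf hHL W p
    hX.1.2.1.1 hX.irr hsurj hX.p_ne_two hr D hc htam fun K _ _ Wd _ _ hK hHN hWd hrd ↦ by
      obtain ⟨hXd, hj⟩ := hX.twist_of_heegner K hK hHN Wd hWd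
      exact hlow Wd hXd hj hrd

/-- **The same with surj(p) decided by `p ∤ ord_p j(E)`** (multr1-p2's
`ClassX4M.surj_of_not_dvd_padicValRat_j`: the inertia at a potentially multiplicative `p` supplies a
transvection; valid at `p = 3` — 73 of the 85 surjective rank-one X4(M) pairs at `p = 3`).
[cite: SilvermanATAEC1994, V.6 Prop. 6.1 (p. 410) and V.5.3] [cite: McCallumLMS1991, §1 Theorem (Kolyvagin), p. 296] -/
theorem ClassX4M.missingUpperBoundAt_rankOne_of_not_dvd_padicValRat_j_of_lowerTwists_of_odd
    (hGZ : ∀ (N : ℕ) [NeZero N] (W : WeierstrassCurve ℚ) (K : Type) [Field K] [NumberField K],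
      gross_zagier N W K)
    (hKo : ∀ (N : ℕ) [NeZero N] (W : WeierstrassCurve ℚ) (K : Type) [Field K] [NumberField K],
      kolyvagin N W K)
    (hB : ∀ (N : ℕ) [NeZero N] (W : WeierstrassCurve ℚ) (K : Type) [Field K] [NumberField K],
      Kolyvagin1990_padicValNat_card_sha_le N W K)
    (hGZK : rank_eq_analyticRank_of_analyticRank_le_one) (hmod : hasEntireLFunction_rat)
    (hnf : exists_isNewformOf) (hHL : HoffsteinLuo1997_exists_twist_L_one_ne_zero)
    [NeZero (W.conductorNorm ℤ)]
    (hX : ClassX4M W p) (hr : W.analyticRank = 1) (hj : ¬ (p : ℤ) ∣ padicValRat p W.j)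
    (D : ModularParametrizationData W (W.conductorNorm ℤ)) (hc : ¬ (p : ℤ) ∣ D.c)
    (htam : ¬ p ∣ W.tamagawaProduct)
    (hlow : ∀ (V : WeierstrassCurve ℚ) [V.IsElliptic] [V.IsGloballyMinimal], ClassX4M V p →
      V.j = W.j → V.analyticRank = 0 → MissingLowerBoundAt V p) :
    MissingUpperBoundAt W p :=
  ClassX4M.missingUpperBoundAt_rankOne_of_surj_of_lowerTwists_of_odd hGZ hKo hB hGZK hmod hnf hHL hX
    hr (ClassX4M.surj_of_not_dvd_padicValRat_j hX hj) D hc htam hlow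

/-- **X4(M) ∧ surj(p), EITHER analytic rank, ANY odd `p` (so `p = 3`): `BSD(E,p)` from LOWER halves
alone, every other input PUBLISHED.** `(E,p) ∈ X4(M)` (`W` globally minimal), `ord_{s=1} L(E,s) ≤ 1`,
`ρ̄_{E,p}` onto, datum `D` at level `N_E` with `p ∤ c(D)` and `p ∤ ∏_ℓ c_ℓ(E)` (both used in rank one
only): if every X4(M) pair `(V,p)` with `j(V) = j(E)` and analytic rank `≤ 1` satisfies
`MissingLowerBoundAt V p`, then `BSDp W p`. Rank `0`: gen 9's `ClassX4M.bsdp_rankZero_of_surj_of_lower`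
(upper half from Delbourgo 1998 Prop. 4 `hDel`, GZK, modularity, Wuthrich Lemma 20 `hL20` (`p = 3`
only), Kato's divisibility on the `ω^{(p−1)/2}`-component `hKato`; NO Tamagawa / Manin / `p ≥ 5`).
Rank `1`: `bsdp_of_bad_rankOne_of_lower_of_lowerTwists_of_odd`, the rank-zero Heegner twists being
X4(M) pairs with the same `j` (`ClassX4M.twist_of_heegner`). Gen 4's `bsdp_of_classX4M_of_lowerHalves`
without `p ≥ 5` and without Kim 2026. X4(M) stays CONSTRUCTION-SHAPED; nothing booked.
[cite: Delbourgo1998, Prop. 4 (p. 144)] [cite: Wuthrich2014, Lemma 20 (p. 399), Thm. 3 (p. 383), Cor. 19 (p. 398)]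
[cite: Kato2004Asterisque, Thm. 17.4 (3) (p. 273)] [cite: McCallumLMS1991, §1 Theorem (Kolyvagin), p. 296]
[cite: HoffsteinLuo1997, Theorem (§1, pp. 435–436)] [cite: Miller2011LMS, Def. 1.1] -/
theorem bsdp_of_classX4M_of_surj_of_lowerHalves_of_odd
    (hDel : Delbourgo1998.prop4_rankZero_pow_dvd_constantCoeff)
    (hmodD : nonempty_modularParametrizationData)
    (hL20 : Wuthrich2014.lemma20_surjective_threeAdic_of_semistable)
    (hKato : Wuthrich2014.kato_halfEigenCharIdeal_dvd_cyclotomicPrime_of_surjective)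
    (hGZ : ∀ (N : ℕ) [NeZero N] (W : WeierstrassCurve ℚ) (K : Type) [Field K] [NumberField K],
      gross_zagier N W K)
    (hKo : ∀ (N : ℕ) [NeZero N] (W : WeierstrassCurve ℚ) (K : Type) [Field K] [NumberField K],
      kolyvagin N W K)
    (hB : ∀ (N : ℕ) [NeZero N] (W : WeierstrassCurve ℚ) (K : Type) [Field K] [NumberField K],
      Kolyvagin1990_padicValNat_card_sha_le N W K)
    (hnf : exists_isNewformOf) (hHL : HoffsteinLuo1997_exists_twist_L_one_ne_zero)
    (hGZK : rank_eq_analyticRank_of_analyticRank_le_one) (hmod : hasEntireLFunction_rat)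
    [NeZero (W.conductorNorm ℤ)]
    (hX : ClassX4M W p) (hr : W.analyticRank ≤ 1) (hsurj : Surj W p)
    (D : ModularParametrizationData W (W.conductorNorm ℤ)) (hc : ¬ (p : ℤ) ∣ D.c)
    (htam : ¬ p ∣ W.tamagawaProduct)
    (hlow : ∀ (V : WeierstrassCurve ℚ) [V.IsElliptic] [V.IsGloballyMinimal], ClassX4M V p →
      V.j = W.j → V.analyticRank ≤ 1 → MissingLowerBoundAt V p) :
    BSDp W p := by
  rcases Nat.le_one_iff_eq_zero_or_eq_one.mp hr with hr0 | hr1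
  · exact ClassX4M.bsdp_rankZero_of_surj_of_lower hDel hGZK hmod hmodD hL20 hKato hX hr0 hsurj
      (hlow W hX rfl hr)
  · exact bsdp_of_bad_rankOne_of_lower_of_lowerTwists_of_odd hGZ hKo hB hGZK hmod hnf hHL W p
      hX.1.2.1.1 hX.irr hsurj hX.p_ne_two hr1 D hc htam (hlow W hX rfl hr)
      fun K _ _ Wd _ _ hK hHN hWd hrd ↦ by
        obtain ⟨hXd, hj⟩ := hX.twist_of_heegner K hK hHN Wd hWd
        exact hlow Wd hXd hj (by rw [hrd]; exact zero_le_one)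

/-- **The same with surj(p) decided by `p ∤ ord_p j(E)`** (any odd `p`, `p = 3` included).
[cite: SilvermanATAEC1994, V.6 Prop. 6.1 (p. 410) and V.5.3] [cite: Delbourgo1998, Prop. 4 (p. 144)]
[cite: McCallumLMS1991, §1 Theorem (Kolyvagin), p. 296] -/
theorem bsdp_of_classX4M_of_not_dvd_padicValRat_j_of_lowerHalves_of_odd
    (hDel : Delbourgo1998.prop4_rankZero_pow_dvd_constantCoeff)
    (hmodD : nonempty_modularParametrizationData)
    (hL20 : Wuthrich2014.lemma20_surjective_threeAdic_of_semistable)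
    (hKato : Wuthrich2014.kato_halfEigenCharIdeal_dvd_cyclotomicPrime_of_surjective)
    (hGZ : ∀ (N : ℕ) [NeZero N] (W : WeierstrassCurve ℚ) (K : Type) [Field K] [NumberField K],
      gross_zagier N W K)
    (hKo : ∀ (N : ℕ) [NeZero N] (W : WeierstrassCurve ℚ) (K : Type) [Field K] [NumberField K],
      kolyvagin N W K)
    (hB : ∀ (N : ℕ) [NeZero N] (W : WeierstrassCurve ℚ) (K : Type) [Field K] [NumberField K],
      Kolyvagin1990_padicValNat_card_sha_le N W K)
    (hnf : exists_isNewformOf) (hHL : HoffsteinLuo1997_exists_twist_L_one_ne_zero)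
    (hGZK : rank_eq_analyticRank_of_analyticRank_le_one) (hmod : hasEntireLFunction_rat)
    [NeZero (W.conductorNorm ℤ)]
    (hX : ClassX4M W p) (hr : W.analyticRank ≤ 1) (hj : ¬ (p : ℤ) ∣ padicValRat p W.j)
    (D : ModularParametrizationData W (W.conductorNorm ℤ)) (hc : ¬ (p : ℤ) ∣ D.c)
    (htam : ¬ p ∣ W.tamagawaProduct)
    (hlow : ∀ (V : WeierstrassCurve ℚ) [V.IsElliptic] [V.IsGloballyMinimal], ClassX4M V p →
      V.j = W.j → V.analyticRank ≤ 1 → MissingLowerBoundAt V p) :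
    BSDp W p :=
  bsdp_of_classX4M_of_surj_of_lowerHalves_of_odd hDel hmodD hL20 hKato hGZ hKo hB hnf hHL hGZK hmod hX
    hr (ClassX4M.surj_of_not_dvd_padicValRat_j hX hj) D hc htam hlow

end Summit.BirchSwinnertonDyer.Rank1Residual.AdditivePotMult

end
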